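import Literature.NumberTheory.LFunctions.WeilExplicitContinuous
import Literature.NumberTheory.LFunctions.ZetaScrew
import HarnessLib

/-!
# T45 — The tent test function: Mellin transform, polar and prime terms

Towards a PROOF of the named fact `Literature.NumberTheory.LFunctions.Suzuki2023_thm11_series`
(Suzuki, J. Lond. Math. Soc. 108 (2023), Thm 1.1 (2): `Ψ(t) = ∑_ρ m(ρ)(cosh((ρ−½)t) − 1)/(ρ−½)²`),
the one hypothesis of T43/T43′/T44 (`SoloInformedScrew*`). The mechanism: Suzuki's series is the
Guinand–Weil explicit formula (`explicit_formula_continuous`, tree) for the TENT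
`Δ_t(x) = (t − |x|)₊/2`, whose transform is `Δ̂_t(s) = (cosh((s−½)t) − 1)/(s−½)²`.

This file: the tent (`tent`), its continuity / compact support / Lipschitz bound, the core
integral `∫₀^t (t − x)e^{wx} dx = (e^{wt} − 1 − wt)/w²` (`integral_tentCore`), the transform
(`weilMellin_tent`), its value on the critical line `(1 − cos(ut))/u²` and the bound
`‖Δ̂_t(½+iu)‖ ≤ (t²+4)/(1+u²)` (`norm_weilMellin_tent_line_le`), the polar term
`Δ̂_t(0) + Δ̂_t(1) = 4(e^{t/2} + e^{−t/2} − 2)` and the prime term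
`weilPrimeTerm Δ_t = zetaScrewPrimeSum t` — i.e. the first two of the four parts of `zetaScrew_eq`.
-/

noncomputable section

open scoped Real Topology
open Complex Filter Set MeasureTheory Literature.NumberTheory.LFunctions

namespace Summit.RiemannHypothesis.RiemannHypothesis.Theorems

/-! ## The tent -/

/-- The tent `Δ_t(x) = (t − |x|)₊ / 2` (complex-valued). -/
def tent (t : ℝ) (x : ℝ) : ℂ := (((max (t - |x|) 0) / 2 : ℝ) : ℂ)

/-- Unfolding the tent. -/
theorem tent_apply (t x : ℝ) : tent t x = (((max (t - |x|) 0) / 2 : ℝ) : ℂ) := rfl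

/-- The tent is continuous. -/
theorem continuous_tent (t : ℝ) : Continuous (tent t) :=
  Complex.continuous_ofReal.comp
    (((continuous_const.sub continuous_abs).max continuous_const).div_const _)

/-- The tent vanishes for `|x| ≥ t`. -/
theorem tent_eq_zero {t x : ℝ} (hx : t ≤ |x|) : tent t x = 0 := by
  simp [tent, max_eq_right (sub_nonpos.2 hx)]

/-- On `|x| ≤ t` the tent is `(t − |x|)/2`. -/
theorem tent_of_abs_le {t x : ℝ} (hx : |x| ≤ t) : tent t x = ((t : ℂ) - (|x| : ℝ)) / 2 := by
  rw [tent, max_eq_left (sub_nonneg.2 hx)]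
  push_cast
  ring

/-- On `[0, t]` the tent is `(t − x)/2`. -/
theorem tent_of_mem_Icc {t x : ℝ} (hx : x ∈ Icc 0 t) : tent t x = ((t : ℂ) - x) / 2 := by
  rw [tent_of_abs_le (by rw [abs_of_nonneg hx.1]; exact hx.2), abs_of_nonneg hx.1]

/-- `Δ_t(0) = t/2`. -/
theorem tent_zero (t : ℝ) (ht : 0 ≤ t) : tent t 0 = (t : ℂ) / 2 := by
  rw [tent_of_mem_Icc ⟨le_rfl, ht⟩]; simp

/-- The tent is even. -/
@[simp] theorem tent_neg (t x : ℝ) : tent t (-x) = tent t x := by simp [tent, abs_neg]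

/-- The tent vanishes for `|x| > t`. -/
theorem tent_eq_zero_of_lt {t x : ℝ} (hx : t < |x|) : tent t x = 0 := tent_eq_zero hx.le

/-- The tent vanishes off `[−t, t]`. -/
theorem tent_eq_zero_of_not_mem {t x : ℝ} (hx : x ∉ Icc (-t) t) : tent t x = 0 := by
  refine tent_eq_zero_of_lt ?_
  rw [mem_Icc, not_and_or, not_le, not_le] at hx
  rcases hx with h | h
  · exact lt_of_lt_of_le (by linarith) (neg_le_abs x)
  · exact lt_of_lt_of_le h (le_abs_self x)

/-- The tent has compact support. -/
theorem hasCompactSupport_tent (t : ℝ) : HasCompactSupport (tent t) :=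
  HasCompactSupport.intro (isCompact_Icc (a := -t) (b := t)) fun _ hx ↦
    tent_eq_zero_of_not_mem hx

/-- `‖Δ_t(x)‖ ≤ t/2`. -/
theorem norm_tent_le {t : ℝ} (ht : 0 ≤ t) (x : ℝ) : ‖tent t x‖ ≤ t / 2 := by
  rw [tent, Complex.norm_real, Real.norm_of_nonneg (by positivity)]
  have : max (t - |x|) 0 ≤ t := max_le (by linarith [abs_nonneg x]) ht
  linarith

/-- The tent is `½`-Lipschitz. -/
theorem norm_tent_sub_le (t x y : ℝ) : ‖tent t x - tent t y‖ ≤ |x - y| / 2 := by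
  rw [tent, tent, ← Complex.ofReal_sub, Complex.norm_real, Real.norm_eq_abs, ← sub_div, abs_div,
    abs_two]
  refine div_le_div_of_nonneg_right ?_ zero_le_two
  calc |max (t - |x|) 0 - max (t - |y|) 0| ≤ |t - |x| - (t - |y|)| := abs_max_sub_max_le_abs _ _ _
    _ = |(|y| - |x|)| := by ring_nf
    _ ≤ |y - x| := abs_abs_sub_abs_le_abs_sub y x
    _ = |x - y| := abs_sub_comm y x

/-! ## The core integral -/

/-- `∫₀^t (t − x) e^{wx} dx = (e^{wt} − 1 − wt)/w²` for `w ≠ 0` (any real `t`). -/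
theorem integral_tentCore (t : ℝ) {w : ℂ} (hw : w ≠ 0) :
    ∫ x in (0 : ℝ)..t, ((t : ℂ) - x) * cexp (w * x) = (cexp (w * t) - 1 - w * t) / w ^ 2 := by
  have hd : ∀ x ∈ uIcc (0 : ℝ) t,
      HasDerivAt (fun y : ℝ ↦ (((t : ℂ) - y) / w + 1 / w ^ 2) * cexp (w * y))
        (((t : ℂ) - x) * cexp (w * x)) x := by
    intro x _
    have ha : HasDerivAt (fun y : ℝ ↦ (y : ℂ)) 1 x := by
      have h := (hasDerivAt_id' x).ofReal_comp
      rwa [Complex.ofReal_one] at h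
    have hb : HasDerivAt (fun y : ℝ ↦ ((t : ℂ) - y) / w + 1 / w ^ 2) (-1 / w) x :=
      ((ha.const_sub (t : ℂ)).div_const w).add_const (1 / w ^ 2)
    have hc : HasDerivAt (fun y : ℝ ↦ cexp (w * y)) (cexp (w * x) * (w * 1)) x :=
      (ha.const_mul w).cexp
    refine (hb.mul hc).congr_deriv ?_
    field_simp
    ring
  have hi : IntervalIntegrable (fun x : ℝ ↦ ((t : ℂ) - x) * cexp (w * x)) volume 0 t :=
    (by fun_prop : Continuous fun x : ℝ ↦ ((t : ℂ) - x) * cexp (w * x)).intervalIntegrable _ _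
  rw [intervalIntegral.integral_eq_sub_of_hasDerivAt hd hi]
  simp only [Complex.ofReal_zero, sub_zero, mul_zero, Complex.exp_zero, mul_one, sub_self, zero_div,
    zero_add]
  field_simp
  ring

/-! ## The transform of the tent -/

/-- The integrand of `Δ̂_t(s)` vanishes off `(−t, t]`. -/
theorem support_tent_mul_subset (t : ℝ) (w : ℂ) :
    Function.support (fun x : ℝ ↦ tent t x * cexp (w * x)) ⊆ Ioc (-t) t := by
  intro x hx
  rw [Function.mem_support] at hx
  by_contra h
  apply hx
  have : t ≤ |x| := by
    rw [mem_Ioc, not_and_or, not_lt, not_le] at h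
    rcases h with h | h
    · exact le_trans (by linarith) (neg_le_abs x)
    · exact h.le.trans (le_abs_self x)
  rw [tent_eq_zero this, zero_mul]

/-- **Transform of the tent**: `Δ̂_t(s) = (cosh((s − ½)t) − 1)/(s − ½)²` for `s ≠ ½`, `t ≥ 0`. -/
theorem weilMellin_tent {t : ℝ} (ht : 0 ≤ t) {s : ℂ} (hs : s ≠ 1 / 2) :
    weilMellin (tent t) s = (Complex.cosh ((s - 1 / 2) * t) - 1) / (s - 1 / 2) ^ 2 := by
  set w : ℂ := s - 1 / 2 with hw
  have hw0 : w ≠ 0 := sub_ne_zero.2 hs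
  have hnw0 : -w ≠ 0 := neg_ne_zero.2 hw0
  unfold weilMellin
  rw [← hw, ← intervalIntegral.integral_eq_integral_of_support_subset (support_tent_mul_subset t w)]
  have hci : ∀ a b : ℝ, IntervalIntegrable (fun x : ℝ ↦ tent t x * cexp (w * x)) volume a b :=
    fun a b ↦ ((continuous_tent t).mul (by fun_prop)).intervalIntegrable a b
  rw [← intervalIntegral.integral_add_adjacent_intervals (hci (-t) 0) (hci 0 t)]
  -- right half
  have hR : ∫ x in (0 : ℝ)..t, tent t x * cexp (w * x) =
      (1 / 2) * ((cexp (w * t) - 1 - w * t) / w ^ 2) := by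
    rw [← integral_tentCore t hw0, ← intervalIntegral.integral_const_mul]
    refine intervalIntegral.integral_congr fun x hx ↦ ?_
    rw [uIcc_of_le ht] at hx
    simp only [tent_of_mem_Icc hx]
    ring
  -- left half, by `x ↦ −x`
  have hL : ∫ x in (-t : ℝ)..0, tent t x * cexp (w * x) =
      (1 / 2) * ((cexp (-w * t) - 1 - -w * t) / (-w) ^ 2) := by
    have e : ∫ x in (-t : ℝ)..0, tent t x * cexp (w * x) =
        ∫ x in (0 : ℝ)..t, tent t (-x) * cexp (w * ((-x : ℝ) : ℂ)) := by
      rw [intervalIntegral.integral_comp_neg (fun x : ℝ ↦ tent t x * cexp (w * x)), neg_zero]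
    rw [e, ← integral_tentCore t hnw0, ← intervalIntegral.integral_const_mul]
    refine intervalIntegral.integral_congr fun x hx ↦ ?_
    rw [uIcc_of_le ht] at hx
    simp only [tent_neg, tent_of_mem_Icc hx]
    push_cast
    ring_nf
  rw [hL, hR, Complex.cosh]
  have e1 : cexp (-w * t) = cexp (-(w * t)) := by ring_nf
  rw [e1]
  field_simp
  ring

/-- On the critical line: `Δ̂_t(½ + iu) = (1 − cos(ut))/u²` (`u ≠ 0`). -/
theorem weilMellin_tent_line {t : ℝ} (ht : 0 ≤ t) {u : ℝ} (hu : u ≠ 0) :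
    weilMellin (tent t) (1 / 2 + u * I) = (((1 - Real.cos (u * t)) / u ^ 2 : ℝ) : ℂ) := by
  have hs : (1 / 2 : ℂ) + u * I ≠ 1 / 2 := by
    intro h
    have := congrArg Complex.im h
    simp at this
    exact hu this
  rw [weilMellin_tent ht hs, add_sub_cancel_left]
  have e1 : (u : ℂ) * I * t = ((u * t : ℝ) : ℂ) * I := by push_cast; ring
  rw [e1, Complex.cosh_mul_I, ← Complex.ofReal_cos]
  have e2 : ((u : ℂ) * I) ^ 2 = -((u : ℂ) ^ 2) := by
    rw [mul_pow, Complex.I_sq]; ring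
  rw [e2]
  have hu2 : (u : ℂ) ^ 2 ≠ 0 := pow_ne_zero _ (Complex.ofReal_ne_zero.2 hu)
  push_cast
  field_simp
  ring

/-- `1 − cos θ ≤ θ²/2`. -/
theorem one_sub_cos_le_sq_half (θ : ℝ) : 1 - Real.cos θ ≤ θ ^ 2 / 2 := by
  have := Real.one_sub_sq_div_two_le_cos (x := θ)
  linarith

/-- **Decay on the critical line**: `‖Δ̂_t(½ + iu)‖ ≤ (t² + 4)/(1 + u²)` for `u ≠ 0`. -/
theorem norm_weilMellin_tent_line_le {t : ℝ} (ht : 0 ≤ t) {u : ℝ} (hu : u ≠ 0) :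
    ‖weilMellin (tent t) (1 / 2 + u * I)‖ ≤ (t ^ 2 + 4) / (1 + u ^ 2) := by
  rw [weilMellin_tent_line ht hu, Complex.norm_real, Real.norm_of_nonneg
    (div_nonneg (by linarith [Real.cos_le_one (u * t)]) (sq_nonneg u))]
  have hu2 : 0 < u ^ 2 := by positivity
  rw [div_le_div_iff₀ hu2 (by positivity)]
  have h1 : 1 - Real.cos (u * t) ≤ (u * t) ^ 2 / 2 := one_sub_cos_le_sq_half _
  have h2 : 1 - Real.cos (u * t) ≤ 2 := by linarith [Real.neg_one_le_cos (u * t)]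
  have h0 : 0 ≤ 1 - Real.cos (u * t) := by linarith [Real.cos_le_one (u * t)]
  -- `(1 − cos)(1 + u²) = (1 − cos) + (1 − cos)u² ≤ 2 + u²t²/2·… ≤ (t²+4)u²`? use both bounds
  nlinarith [mul_le_mul_of_nonneg_right h1 (le_of_lt hu2), sq_nonneg (u * t), sq_nonneg t,
    mul_nonneg h0 hu2.le]

/-! ## Polar and prime terms -/

/-- **Polar term of the tent**: `Δ̂_t(0) + Δ̂_t(1) = 4(e^{t/2} + e^{−t/2} − 2)`. -/
theorem weilPolarTerm_tent {t : ℝ} (ht : 0 ≤ t) :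
    weilPolarTerm (tent t) = ((4 * (Real.exp (t / 2) + Real.exp (-(t / 2)) - 2) : ℝ) : ℂ) := by
  unfold weilPolarTerm
  rw [weilMellin_tent ht (by norm_num), weilMellin_tent ht (by norm_num), Complex.cosh, Complex.cosh]
  have e1 : ((0 : ℂ) - 1 / 2) * t = -((t : ℂ) / 2) := by ring
  have e2 : ((1 : ℂ) - 1 / 2) * t = (t : ℂ) / 2 := by ring
  rw [e1, e2, neg_neg]
  have e3 : cexp ((t : ℂ) / 2) = ((Real.exp (t / 2) : ℝ) : ℂ) := by push_cast; rfl
  have e4 : cexp (-((t : ℂ) / 2)) = ((Real.exp (-(t / 2)) : ℝ) : ℂ) := by push_cast; rfl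
  rw [e3, e4]
  push_cast
  ring

/-- **Prime term of the tent**: `∑ Λ(n)n^{-1/2}(Δ_t(log n) + Δ_t(−log n)) = ∑_{n ≤ e^t} Λ(n)n^{-1/2}(t − log n)`
`= zetaScrewPrimeSum t`. -/
theorem weilPrimeTerm_tent {t : ℝ} (ht : 0 ≤ t) :
    weilPrimeTerm (tent t) = (zetaScrewPrimeSum t : ℂ) := by
  unfold weilPrimeTerm zetaScrewPrimeSum
  rw [abs_of_nonneg ht, Complex.ofReal_sum, tsum_eq_sum (s := Finset.Icc 1 ⌊Real.exp t⌋₊)]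
  · refine Finset.sum_congr rfl fun n hn ↦ ?_
    rw [Finset.mem_Icc] at hn
    have hn0 : (0 : ℝ) < n := by exact_mod_cast hn.1
    have hlog0 : 0 ≤ Real.log n := Real.log_nonneg (by exact_mod_cast hn.1)
    have hle : Real.log n ≤ t := by
      rw [Real.log_le_iff_le_exp hn0]; exact (Nat.le_floor_iff (Real.exp_pos _).le).1 hn.2
    rw [tent_neg, tent_of_abs_le (by rwa [abs_of_nonneg hlog0]), abs_of_nonneg hlog0]
    push_cast
    ring
  · intro n hn
    rw [Finset.mem_Icc, not_and_or, not_le, not_le] at hn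
    rcases hn with h | h
    · have h0 : n = 0 := by omega
      subst h0
      simp
    · have hn0 : (0 : ℝ) < n := by exact_mod_cast (show 0 < n by omega)
      have hgt : t < Real.log n := by
        rw [Real.lt_log_iff_exp_lt hn0]; exact (Nat.floor_lt (Real.exp_pos _).le).1 h
      rw [tent_neg, tent_eq_zero_of_lt (by rwa [abs_of_nonneg (ht.trans hgt.le)])]
      simp

end Summit.RiemannHypothesis.RiemannHypothesis.Theorems

end
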